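import Summits.Langlands.Langlands.Theorems.TatePhantomLift
import Literature.NumberTheory.GaloisRepresentations.CyclicExtensionOfInvariantRep

/-!
(Census twin part 1/2 — `SchurObstructionExitPrelude`: §0 pieces, §1 abstract kernel, §2 Galois kernel of the lens-4 g28 node
`SchurObstructionExit` (sha256 8da153df…), split at `end Galois` for the ≤ 400-line rule; part 2 = `Theorems/SchurObstructionExit.lean`.)

# SchurObstructionExit — «a minimal counterexample to the extension crux EXT lives on a SCHUR-TORSION layer; on every other
# perfect layer the invariant irreducible relative avatar extends ON THE NOSE» (decomp-langlands · lens 4 «minimal-counterexample /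
# extremal reduction» · generation 28)

TARGET (node-local, BY NAME — the g25/g26 piece is now a tree declaration): **EXT** =
`Summit.Langlands.Langlands.Theorems.TatePhantomLift.PerfectLayerExtension` (sha12 of the statement text `330085e4f017`), the deciding crux of the
queued child route `PerfectLayerClifford` (`--refines route-Langlands-GaloisHullLift:PerfectHullDescent`, stmt-Langlands-28225).

THE EXTREMAL REDUCTION.  Let `(π, L/K, r)` be a counterexample to EXT with `G := Gal(L/K)` (perfect) and `r : Γ_L → GL_n(ℚ̄_ℓ)` irreducible.
(1) `r` is `Γ_K`-invariant (tree `relAvatar_invariant`, PROVED).  (2) The CLIFFORD EXTENSION GROUP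
`E(r) := {(γ, P) ∈ Γ_K × GL_n : P implements θ_γ on r}` surjects onto `Γ_K` with kernel the scalars (Schur), and `Γ_L ↪ E(r)`, `σ ↦ (res σ, r σ)`,
is normal; so `E(r)/Γ_L` is a central extension of the FINITE group `G` by `ℚ̄_ℓˣ`, and EXT(instance) ⟺ it splits.  (3) Given the determinant
descent **W1** (`det r = Ψ|Γ_L`, the GL₁ avatar of the central character; S-implied, EXT-implied) cut down to
`E_Ψ(r) := {(γ, P) ∈ E(r) : det P = Ψ γ}`: still surjective (n-th roots of scalars in `ℚ̄_ℓ`), kernel `μ_n`; so the obstruction is a central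
extension of `G` by `μ_n` — an element of `H²(G, μ_n) = Hom(M(G), ℤ/n)` (`G` perfect).  (4) Hence a minimal counterexample has a layer group
`G` admitting a NON-SPLIT central extension with kernel of exponent dividing `n` («Schur-torsion layer»: `gcd(n, exp M(G)) ≠ 1`); on every
other perfect layer EXT HOLDS OUTRIGHT given W1 (`schurSplit_of_w1`, 0 sorry), and on SUPERPERFECT layers (`M(G) = 0`: `SL₂(𝔽_5)`, `SL₂(𝔽_q)`,
`6·A₆`, `M₁₁`, …) EXT holds with NO input at all (`ext_on_superperfect`, 0 sorry — the BC5 witness).  Continuity of the extension is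
automatic (a homomorphism continuous on the open subgroup `Γ_L`).  Everything is typed WITHOUT cohomology: «every central extension
`1 → Z → E → G → 1` with `Z ≤ Z(E)`, `Z^e = 1` splits» is the predicate `CentralExtensionsSplitMod e G` (quantifying over `E : Type`).

NET EFFECT.  EXT ⟸ W1 ∧ SCHT with SCHT := EXT on Schur-torsion layers (declared residual, EXT-implied, strictly fewer instances), and the
exactness `ext_iff : EXT ↔ W1 ∧ SCHT` is FACT-FREE (g26's `ext_iff_pieces` needed TP = Tate's `H²(Γ_K, ℚ/ℤ) = 0`, DIV, LAY and RIGID as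
side hypotheses).  Composed with the g26 phantom-twist chain (re-run here with the layer predicate threaded, `scht_of_pieces`):
SCHT ⟸ TP ∧ W1 ∧ DIV ∧ LAY ∧ RIGID ∧ ELCR♯, where ELCR♯ = g26's residual ELCR restricted to Schur-torsion layers — strictly below ELCR.
Host corollaries BY NAME: `closes_host : RIGID → FINTYPE → RED° → W1 → SCHT → GaloisHullLift.PerfectHullDescent`, `closes_parent`, `closes_grandparent`.

PIECES of `closes` (both binders consumed): W1 `LayerDeterminantDescent` (tree decl, support, S-implied, EXT-implied) · SCHT
`SchurTorsionLayerExtension` (NEW, declared residual, S-implied, EXT-implied).  PROVED CELLS: `schurSplit_of_w1 : W1 → SchurSplitLayerExtension`,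
`ext_on_superperfect : SuperperfectLayerExtension`.

References: A. H. Clifford, Ann. of Math. 38 (1937) §§3–5 (the factor set of an invariant irreducible); I. Schur (1904/1907) /
Isaacs, Character theory of finite groups, Thm 11.7 & Cor 11.46–(8.16) (extension obstruction in `H²(G/N, ℂˣ)`, order dividing
`n·o(det)`; trivial Schur multiplier ⟹ invariant irreducibles extend); Karpilovsky, The Schur multiplier, LMS Monographs 2 (1987) Ch. 2–3.
-/

set_option linter.dupNamespace false
set_option linter.unusedVariables false
set_option linter.style.longLine false

namespace Summit.Langlands.Langlands.Theorems.SchurObstructionExit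

open scoped BigOperators Topology Matrix
open Filter Set Function
open Literature.NumberTheory.GaloisRepresentations Literature.NumberTheory.Automorphic
open IsDedekindDomain
open Summit.Langlands.Langlands.Theses
open Summit.Langlands.Langlands.Theses.GaloisHullLift
open Summit.Langlands.Langlands.Theorems.TatePhantomLift
open scoped NumberField Polynomial

/-! ## §0 The pieces (TARGET = tree `TatePhantomLift.PerfectLayerExtension`, W1 = tree `TatePhantomLift.LayerDeterminantDescent`) -/

/-- **Every central extension of `Q` whose kernel is killed by `e` splits** — typed without cohomology: for every group `E` and every
surjection `p : E → Q` with `ker p` central and of exponent dividing `e` there is a homomorphic section.  For a finite perfect `Q` and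
`e ≥ 1` this says `Hom(M(Q), ℤ/e) = 0`, i.e. `gcd(e, exp M(Q)) = 1`; for `e = 0` (no torsion condition) it says `Q` is superperfect. -/
def CentralExtensionsSplitMod (e : ℕ) (Q : Type) [Group Q] : Prop :=
  ∀ (E : Type) [Group E] (p : E →* Q), Function.Surjective p → (∀ z : E, p z = 1 → z ∈ Subgroup.center E) →
    (∀ z : E, p z = 1 → z ^ e = 1) → ∃ s : Q →* E, ∀ x : Q, p (s x) = x

/-- **SPLIT · PROVED CELL (from W1)** — EXT on the layers `L/K` whose Galois group has all central `μ_n`-type extensions split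
(`CentralExtensionsSplitMod n (L ≃ₐ[K] L)`): every perfect layer with `gcd(n, exp M(Gal(L/K))) = 1`. -/
def SchurSplitLayerExtension : Prop :=
  ∀ (K : Type) [Field K] [NumberField K] (n : ℕ) (hcpt : Literature.NumberTheory.Automorphic.isCompact_glFiniteIntegralLevel n K), 0 < n → ∀ (π : Literature.NumberTheory.Automorphic.CuspidalAutomorphicRepData n K hcpt), π.1.IsLAlgebraic → ∀ (L : Type) [Field L] [NumberField L] [Algebra K L], IsGalois K L → Module.finrank K L ≠ 1 → (¬ ∃ F : IntermediateField K L, F ≠ ⊥ ∧ IsGalois K ↥F ∧ IsCyclic (↥F ≃ₐ[K] ↥F) ∧ (Module.finrank K ↥F).Prime) → CentralExtensionsSplitMod n (L ≃ₐ[K] L) → ∀ (ℓ : ℕ) [Fact ℓ.Prime] (ι : PadicAlgCl ℓ ≃+* ℂ) (r : Literature.NumberTheory.GaloisRepresentations.FramedGaloisRep L (PadicAlgCl ℓ) n), r.toGaloisRep.IsSemisimple → r.IsIrreducible → (∀ᶠ w : IsDedekindDomain.HeightOneSpectrum (NumberField.RingOfIntegers L) in cofinite, ∀ (v : IsDedekindDomain.HeightOneSpectrum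 (NumberField.RingOfIntegers K)) (α : Multiset ℂ), w.asIdeal.under (NumberField.RingOfIntegers K) = v.asIdeal → π.1.HasSatakeParamAt v α → r.IsUnramifiedAt w ∧ r.HasFrobCharpolyAt w (Literature.NumberTheory.Automorphic.arithFrobPolyOfSatake ι w.residueCard 1 (α.map (fun a => a ^ w.asIdeal.inertiaDeg (NumberField.RingOfIntegers K))))) → ∃ ρ₀ : Literature.NumberTheory.GaloisRepresentations.FramedGaloisRep K (PadicAlgCl ℓ) n, ρ₀.toGaloisRep.IsSemisimple ∧ (∀ᶠ w : IsDedekindDomain.HeightOneSpectrum (NumberField.RingOfIntegers L) in cofinite, ∀ (v : IsDedekindDomain.HeightOneSpectrum (NumberField.RingOfIntegers K)) (α : Multiset ℂ), w.asIdeal.under (NumberField.RingOfIntegers K) = v.asIdeal → π.1.HasSatakeParamAt v α → (ρ₀.restrictField L).IsUnramifiedAt w ∧ (ρ₀.restrictField L).HasFrobCharpolyAt w (Literature.NumberTheory.Automorphic.arithFrobPolyOfSatake ι w.residueCard 1 (α.map (fun a => a ^ w.asIdeal.inertiaDeg (NumberField.RingOfIntegers K)))))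

/-- **SCHT · DECLARED RESIDUAL · S-implied · EXT-implied** — EXT on the SCHUR-TORSION layers: `Gal(L/K)` admits a non-split central extension
with kernel of exponent dividing `n` (`gcd(n, exp M(Gal(L/K))) ≠ 1`; smallest cases `A₅, PSL₂(7), A₆` with `n` even, `PSL₃(4)` with
`gcd(n,12) ≠ 1`).  Why it might fail: it is implied by EXT (`scht_of_ext`), hence by S; genuinely open — this is where projective relative
avatars need not linearise over `K`. -/
def SchurTorsionLayerExtension : Prop :=
  ∀ (K : Type) [Field K] [NumberField K] (n : ℕ) (hcpt : Literature.NumberTheory.Automorphic.isCompact_glFiniteIntegralLevel n K), 0 < n → ∀ (π : Literature.NumberTheory.Automorphic.CuspidalAutomorphicRepData n K hcpt), π.1.IsLAlgebraic → ∀ (L : Type) [Field L] [NumberField L] [Algebra K L], IsGalois K L → Module.finrank K L ≠ 1 → (¬ ∃ F : IntermediateField K L, F ≠ ⊥ ∧ IsGalois K ↥F ∧ IsCyclic (↥F ≃ₐ[K] ↥F) ∧ (Module.finrank K ↥F).Prime) → ¬ CentralExtensionsSplitMod n (L ≃ₐ[K] L) → ∀ (ℓ : ℕ) [Fact ℓ.Prime]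 (ι : PadicAlgCl ℓ ≃+* ℂ) (r : Literature.NumberTheory.GaloisRepresentations.FramedGaloisRep L (PadicAlgCl ℓ) n), r.toGaloisRep.IsSemisimple → r.IsIrreducible → (∀ᶠ w : IsDedekindDomain.HeightOneSpectrum (NumberField.RingOfIntegers L) in cofinite, ∀ (v : IsDedekindDomain.HeightOneSpectrum (NumberField.RingOfIntegers K)) (α : Multiset ℂ), w.asIdeal.under (NumberField.RingOfIntegers K) = v.asIdeal → π.1.HasSatakeParamAt v α → r.IsUnramifiedAt w ∧ r.HasFrobCharpolyAt w (Literature.NumberTheory.Automorphic.arithFrobPolyOfSatake ι w.residueCard 1 (α.map (fun a => a ^ w.asIdeal.inertiaDeg (NumberField.RingOfIntegers K))))) → ∃ ρ₀ : Literature.NumberTheory.GaloisRepresentations.FramedGaloisRep K (PadicAlgCl ℓ) n, ρ₀.toGaloisRep.IsSemisimple ∧ (∀ᶠ w : IsDedekindDomain.HeightOneSpectrum (NumberField.RingOfIntegers L) in cofinite, ∀ (v : IsDedekindDomain.HeightOneSpectrum (NumberField.RingOfIntegers K)) (α : Multiset ℂ), w.asIdeal.under (NumberField.RingOfIntegers K)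 = v.asIdeal → π.1.HasSatakeParamAt v α → (ρ₀.restrictField L).IsUnramifiedAt w ∧ (ρ₀.restrictField L).HasFrobCharpolyAt w (Literature.NumberTheory.Automorphic.arithFrobPolyOfSatake ι w.residueCard 1 (α.map (fun a => a ^ w.asIdeal.inertiaDeg (NumberField.RingOfIntegers K)))))

/-- **SUPERPERFECT RUNG (PROVED, fact-free)** — EXT on the layers whose Galois group has ALL central extensions split (superperfect `Gal(L/K)`:
`SL₂(𝔽_5)`, `SL₂(𝔽_q)` (`q ≠ 4, 9`), `6·A₆`, `M₁₁`, …), with no determinant input. -/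
def SuperperfectLayerExtension : Prop :=
  ∀ (K : Type) [Field K] [NumberField K] (n : ℕ) (hcpt : Literature.NumberTheory.Automorphic.isCompact_glFiniteIntegralLevel n K), 0 < n → ∀ (π : Literature.NumberTheory.Automorphic.CuspidalAutomorphicRepData n K hcpt), π.1.IsLAlgebraic → ∀ (L : Type) [Field L] [NumberField L] [Algebra K L], IsGalois K L → Module.finrank K L ≠ 1 → (¬ ∃ F : IntermediateField K L, F ≠ ⊥ ∧ IsGalois K ↥F ∧ IsCyclic (↥F ≃ₐ[K] ↥F) ∧ (Module.finrank K ↥F).Prime) → (∀ (E : Type) [Group E] (p : E →* (L ≃ₐ[K] L)), Function.Surjective p → (∀ z : E, p z = 1 → z ∈ Subgroup.center E) → ∃ s : (L ≃ₐ[K] L) →* E, ∀ x, p (s x) = x) → ∀ (ℓ : ℕ) [Fact ℓ.Prime] (ι : PadicAlgCl ℓ ≃+* ℂ) (r : Literature.NumberTheory.GaloisRepresentations.FramedGaloisRep L (PadicAlgCl ℓ) n), r.toGaloisRep.IsSemisimple → r.IsIrreducible → (∀ᶠ w : IsDedekindDomain.HeightOneSpectrum (NumberField.RingOfIntegers L)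 in cofinite, ∀ (v : IsDedekindDomain.HeightOneSpectrum (NumberField.RingOfIntegers K)) (α : Multiset ℂ), w.asIdeal.under (NumberField.RingOfIntegers K) = v.asIdeal → π.1.HasSatakeParamAt v α → r.IsUnramifiedAt w ∧ r.HasFrobCharpolyAt w (Literature.NumberTheory.Automorphic.arithFrobPolyOfSatake ι w.residueCard 1 (α.map (fun a => a ^ w.asIdeal.inertiaDeg (NumberField.RingOfIntegers K))))) → ∃ ρ₀ : Literature.NumberTheory.GaloisRepresentations.FramedGaloisRep K (PadicAlgCl ℓ) n, ρ₀.toGaloisRep.IsSemisimple ∧ (∀ᶠ w : IsDedekindDomain.HeightOneSpectrum (NumberField.RingOfIntegers L) in cofinite, ∀ (v : IsDedekindDomain.HeightOneSpectrum (NumberField.RingOfIntegers K)) (α : Multiset ℂ), w.asIdeal.under (NumberField.RingOfIntegers K) = v.asIdeal → π.1.HasSatakeParamAt v α → (ρ₀.restrictField L).IsUnramifiedAt w ∧ (ρ₀.restrictField L).HasFrobCharpolyAt w (Literature.NumberTheory.Automorphic.arithFrobPolyOfSatake ι w.residueCard 1 (α.map (fun a => a ^ w.asIdeal.inertiaDeg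 (NumberField.RingOfIntegers K)))))

/-! ## §1 KERNEL, group theory: splitting the Clifford extension group over a normal subgroup with characterless-obstruction quotient (0 sorry) -/

section Abstract

/-- The superperfect condition (all central extensions split) gives the split condition for every exponent. -/
theorem centralExtensionsSplitMod_of_all {Q : Type} [Group Q] (e : ℕ)
    (h : ∀ (E : Type) [Group E] (p : E →* Q), Function.Surjective p → (∀ z : E, p z = 1 → z ∈ Subgroup.center E) →
      ∃ s : Q →* E, ∀ x, p (s x) = x) : CentralExtensionsSplitMod e Q :=
  fun E _ p hp hc _ => h E p hp hc

/-- `e = 1`: every group is «Schur-split for GL₁» (the kernel condition `z ^ 1 = 1` makes `p` bijective), so SCHT is vacuous in rank one. -/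
theorem centralExtensionsSplitMod_one {Q : Type} [Group Q] : CentralExtensionsSplitMod 1 Q := by
  intro E _ p hp hc ht
  have hinj : Function.Injective p := fun a b h => by
    have h1 := ht (a⁻¹ * b) (by rw [map_mul, map_inv, h, inv_mul_cancel])
    rw [pow_one] at h1
    exact inv_mul_eq_one.1 h1
  exact ⟨(MulEquiv.ofBijective p ⟨hinj, hp⟩).symm.toMonoidHom, fun x => MulEquiv.ofBijective_apply_symm_apply p ⟨hinj, hp⟩⟩


variable {Γ H M C Q : Type} [Group Γ] [Group H] [Group M] [CommGroup C] [Group Q]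

/-- **The Clifford extension group splits.**  `f : H ↪ Γ` with normal image and quotient `q : Γ ↠ Q` (`ker q = f(H)`), an «outer action»
`θ` (`f (θ τ σ) = τ f(σ) τ⁻¹`), `r : H → M` with every `θ τ` implemented on `r` by some `P ∈ M` of prescribed «determinant» `D P = Ψ τ`
(`Ψ ∘ f = D ∘ r`), such that the self-intertwiners of `r` of determinant `1` are central and killed by `e` (Schur).  If every central extension
of `Q` with kernel killed by `e` splits, then `r` extends to a homomorphism `R : Γ → M` with `R ∘ f = r`.
Construction: `E_Ψ := {(τ, P) : P implements θ τ, D P = Ψ τ} ≤ Γ × M`, `ι : H → E_Ψ`, `σ ↦ (f σ, r σ)` (normal image); `E_Ψ/ι(H) ↠ Q` is a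
central extension with `e`-torsion kernel; a section `s` gives `S := (mk⁻¹ s(Q)) ≤ E_Ψ` mapping bijectively onto `Γ`, and `R := pr₂ ∘ (pr₁|S)⁻¹`. -/
theorem exists_monoidHom_comp_eq_of_centralExtensionsSplitMod
    (f : H →* Γ) (hf : Function.Injective f) (θ : Γ → H → H) (hθ : ∀ τ σ, f (θ τ σ) = τ * f σ * τ⁻¹)
    (q : Γ →* Q) (hqs : Function.Surjective q) (hq : ∀ τ, q τ = 1 ↔ τ ∈ Set.range f)
    (r : H →* M) (D : M →* C) (Ψ : Γ →* C) (hΨ : ∀ σ, Ψ (f σ) = D (r σ)) (e : ℕ)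
    (hstab : ∀ τ, ∃ P : M, (∀ σ, r (θ τ σ) = P * r σ * P⁻¹) ∧ D P = Ψ τ)
    (hSchur : ∀ P : M, (∀ σ, P * r σ = r σ * P) → D P = 1 → P ^ e = 1 ∧ ∀ X : M, P * X = X * P)
    (hsplit : CentralExtensionsSplitMod e Q) :
    ∃ R : Γ →* M, ∀ σ, R (f σ) = r σ := by
  -- the outer action is an action
  have hθ1 : ∀ σ, θ 1 σ = σ := fun σ => hf (by rw [hθ, one_mul, inv_one, mul_one])
  have hθmul : ∀ τ τ' σ, θ (τ * τ') σ = θ τ (θ τ' σ) := fun τ τ' σ => hf (by rw [hθ, hθ, hθ]; group)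
  have hθf : ∀ σ₀ σ, θ (f σ₀) σ = σ₀ * σ * σ₀⁻¹ := fun σ₀ σ => hf (by rw [hθ, map_mul, map_mul, map_inv])
  have hθinv : ∀ τ σ, θ τ (θ τ⁻¹ σ) = σ := fun τ σ => by rw [← hθmul, mul_inv_cancel, hθ1]
  -- the Clifford extension group cut down by the determinant condition
  obtain ⟨E₀, hE₀⟩ : ∃ E₀ : Subgroup (Γ × M), ∀ x : Γ × M,
      x ∈ E₀ ↔ (∀ σ, r (θ x.1 σ) = x.2 * r σ * x.2⁻¹) ∧ D x.2 = Ψ x.1 := by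
    refine ⟨{ carrier := {x | (∀ σ, r (θ x.1 σ) = x.2 * r σ * x.2⁻¹) ∧ D x.2 = Ψ x.1}
              mul_mem' := fun {a b} ha hb => ?_, one_mem' := ?_, inv_mem' := fun {a} ha => ?_ }, fun x => Iff.rfl⟩
    · rw [Set.mem_setOf_eq] at ha hb ⊢
      obtain ⟨ha, ha'⟩ := ha
      obtain ⟨hb, hb'⟩ := hb
      refine And.intro (fun σ => ?_) ?_
      · rw [Prod.fst_mul, Prod.snd_mul, hθmul, ha, hb]; group
      · rw [Prod.fst_mul, Prod.snd_mul, map_mul, map_mul, ha', hb']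
    · rw [Set.mem_setOf_eq]
      refine And.intro (fun σ => ?_) ?_
      · rw [Prod.fst_one, Prod.snd_one, hθ1, one_mul, inv_one, mul_one]
      · rw [Prod.fst_one, Prod.snd_one, map_one, map_one]
    · rw [Set.mem_setOf_eq] at ha ⊢
      obtain ⟨ha, ha'⟩ := ha
      refine And.intro (fun σ => ?_) ?_
      · have h := ha (θ a.1⁻¹ σ)
        rw [hθinv] at h
        rw [Prod.fst_inv, Prod.snd_inv, h]; group
      · rw [Prod.fst_inv, Prod.snd_inv, map_inv, map_inv, ha']
  have hmemE : ∀ g : E₀, (∀ σ, r (θ (g : Γ × M).1 σ) = (g : Γ × M).2 * r σ * ((g : Γ × M).2)⁻¹) ∧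
      D (g : Γ × M).2 = Ψ (g : Γ × M).1 := fun g => (hE₀ _).1 g.2
  -- `ι : H → E₀`, `σ ↦ (f σ, r σ)`
  have hιmem : ∀ σ₀, (f σ₀, r σ₀) ∈ E₀ := fun σ₀ =>
    (hE₀ _).2 ⟨fun σ => by rw [hθf, map_mul, map_mul, map_inv], (hΨ σ₀).symm⟩
  obtain ⟨ι, hι1, hι2⟩ : ∃ ι : H →* E₀, (∀ σ₀, ((ι σ₀ : E₀) : Γ × M).1 = f σ₀) ∧ ∀ σ₀, ((ι σ₀ : E₀) : Γ × M).2 = r σ₀ := by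
    refine ⟨{ toFun := fun σ₀ => ⟨(f σ₀, r σ₀), hιmem σ₀⟩
              map_one' := Subtype.ext (Prod.ext (by simp) (by simp))
              map_mul' := fun a b => Subtype.ext (Prod.ext (by simp) (by simp)) }, fun σ₀ => rfl, fun σ₀ => rfl⟩
  have hιinj : Function.Injective ι := fun a b h => hf (by rw [← hι1, ← hι1, h])
  -- `ι(H)` is normal in `E₀`
  haveI hN : (ι.range).Normal := ⟨by
    rintro _ ⟨σ₀, rfl⟩ g
    refine ⟨θ (g : Γ × M).1 σ₀, Subtype.ext (Prod.ext ?_ ?_)⟩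
    · rw [hι1, Subgroup.coe_mul, Subgroup.coe_mul, Subgroup.coe_inv, Prod.fst_mul, Prod.fst_mul, Prod.fst_inv, hι1, hθ]
    · rw [hι2, Subgroup.coe_mul, Subgroup.coe_mul, Subgroup.coe_inv, Prod.snd_mul, Prod.snd_mul, Prod.snd_inv, hι2,
        (hmemE g).1 σ₀]⟩
  -- the quotient `Ē := E₀ / ι(H)` and its projection `p̄` onto `Q`
  have hker_le : ι.range ≤ (q.comp ((MonoidHom.fst Γ M).comp E₀.subtype)).ker := by
    rintro _ ⟨σ₀, rfl⟩
    rw [MonoidHom.mem_ker, MonoidHom.comp_apply, MonoidHom.comp_apply, Subgroup.coe_subtype, MonoidHom.coe_fst, hι1]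
    exact (hq _).2 ⟨σ₀, rfl⟩
  set pbar : E₀ ⧸ ι.range →* Q := QuotientGroup.lift ι.range (q.comp ((MonoidHom.fst Γ M).comp E₀.subtype)) hker_le with hpbar
  have hpbar_mk : ∀ g : E₀, pbar (QuotientGroup.mk g) = q (g : Γ × M).1 := fun g => by
    rw [hpbar, QuotientGroup.lift_mk]; rfl
  have hpbars : Function.Surjective pbar := by
    intro x
    obtain ⟨τ, rfl⟩ := hqs x
    obtain ⟨P, hP, hD⟩ := hstab τ
    exact ⟨QuotientGroup.mk ⟨(τ, P), (hE₀ _).2 ⟨hP, hD⟩⟩, by rw [hpbar_mk]⟩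
  -- the kernel of `p̄` is central and killed by `e`
  have hker : ∀ z : E₀ ⧸ ι.range, pbar z = 1 → z ∈ Subgroup.center (E₀ ⧸ ι.range) ∧ z ^ e = 1 := by
    intro z hz
    obtain ⟨g, rfl⟩ := QuotientGroup.mk_surjective z
    rw [hpbar_mk] at hz
    obtain ⟨σ₀, hσ₀⟩ := (hq _).1 hz
    -- `y := g · ι(σ₀)⁻¹` has trivial first coordinate and the same class
    obtain ⟨y, hy⟩ : ∃ y : E₀, y = g * (ι σ₀)⁻¹ := ⟨_, rfl⟩
    have hyg : (QuotientGroup.mk g : E₀ ⧸ ι.range) = QuotientGroup.mk y := by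
      rw [QuotientGroup.eq, hy, inv_mul_cancel_left]
      exact inv_mem ⟨σ₀, rfl⟩
    have hy1 : (y : Γ × M).1 = 1 := by
      rw [hy, Subgroup.coe_mul, Subgroup.coe_inv, Prod.fst_mul, Prod.fst_inv, hι1, hσ₀, mul_inv_cancel]
    obtain ⟨hy₁, hy₂⟩ := hmemE y
    rw [hy1] at hy₁ hy₂
    rw [map_one] at hy₂
    have hcomm : ∀ σ, (y : Γ × M).2 * r σ = r σ * (y : Γ × M).2 := fun σ => by
      have h := hy₁ σ
      rw [hθ1] at h
      calc (y : Γ × M).2 * r σ = ((y : Γ × M).2 * r σ * ((y : Γ × M).2)⁻¹) * (y : Γ × M).2 := by group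
        _ = r σ * (y : Γ × M).2 := by rw [← h]
    obtain ⟨hpow, hcen⟩ := hSchur _ hcomm hy₂
    rw [hyg]
    refine ⟨?_, ?_⟩
    · rw [Subgroup.mem_center_iff]
      intro w
      obtain ⟨g', rfl⟩ := QuotientGroup.mk_surjective w
      rw [← QuotientGroup.mk_mul, ← QuotientGroup.mk_mul]
      congr 1
      refine Subtype.ext (Prod.ext ?_ ?_)
      · rw [Subgroup.coe_mul, Subgroup.coe_mul, Prod.fst_mul, Prod.fst_mul, hy1, mul_one, one_mul]
      · rw [Subgroup.coe_mul, Subgroup.coe_mul, Prod.snd_mul, Prod.snd_mul, hcen]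
    · have hye : y ^ e = 1 := Subtype.ext (Prod.ext
        (by rw [Subgroup.coe_pow, Subgroup.coe_one, Prod.pow_fst, Prod.fst_one, hy1, one_pow])
        (by rw [Subgroup.coe_pow, Subgroup.coe_one, Prod.pow_snd, Prod.snd_one, hpow]))
      rw [← QuotientGroup.mk_pow, hye, QuotientGroup.mk_one]
  -- a homomorphic section of `p̄`
  obtain ⟨s, hs⟩ := hsplit (E₀ ⧸ ι.range) pbar hpbars (fun z hz => (hker z hz).1) (fun z hz => (hker z hz).2)
  -- `S := mk⁻¹ (s(Q))` maps bijectively onto `Γ`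
  set S : Subgroup E₀ := (s.range).comap (QuotientGroup.mk' ι.range) with hSdef
  have hmemS : ∀ g : E₀, g ∈ S ↔ (QuotientGroup.mk g : E₀ ⧸ ι.range) ∈ s.range := fun g => by
    rw [hSdef, Subgroup.mem_comap, QuotientGroup.mk'_apply]
  have hιS : ∀ σ₀, ι σ₀ ∈ S := fun σ₀ => by
    rw [hmemS, (QuotientGroup.eq_one_iff (N := ι.range) (ι σ₀)).2 ⟨σ₀, rfl⟩]
    exact one_mem _
  set π₁ : S →* Γ := ((MonoidHom.fst Γ M).comp E₀.subtype).comp S.subtype with hπ₁def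
  have hπ₁ : ∀ a : S, π₁ a = ((a : E₀) : Γ × M).1 := fun a => rfl
  have hinj : Function.Injective π₁ := by
    intro a b hab
    rw [hπ₁, hπ₁] at hab
    have hd : ((a : E₀)⁻¹ * b : E₀) ∈ S := S.mul_mem (S.inv_mem a.2) b.2
    have hd1 : ((((a : E₀)⁻¹ * b : E₀)) : Γ × M).1 = 1 := by
      rw [Subgroup.coe_mul, Subgroup.coe_inv, Prod.fst_mul, Prod.fst_inv, hab, inv_mul_cancel]
    rw [hmemS] at hd
    obtain ⟨y₀, hy₀⟩ := hd
    have hy₀1 : y₀ = 1 := by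
      have h := congrArg pbar hy₀
      rw [hs, hpbar_mk, hd1, map_one] at h
      exact h
    rw [hy₀1, map_one] at hy₀
    have hdN : ((a : E₀)⁻¹ * b : E₀) ∈ ι.range := (QuotientGroup.eq_one_iff (N := ι.range) _).1 hy₀.symm
    obtain ⟨σ₀, hσ₀⟩ := hdN
    have hσ₀1 : σ₀ = 1 := hf (by
      have h := congrArg (fun x : E₀ => (x : Γ × M).1) hσ₀
      simp only [hι1] at h
      rw [h, hd1, map_one])
    rw [hσ₀1, map_one] at hσ₀
    exact Subtype.ext (inv_mul_eq_one.1 hσ₀.symm)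
  have hsurj : Function.Surjective π₁ := by
    intro τ
    obtain ⟨g, hg⟩ := QuotientGroup.mk_surjective (s (q τ))
    have h1 : q ((g : Γ × M).1) = q τ := by rw [← hpbar_mk, hg, hs]
    obtain ⟨σ₀, hσ₀⟩ : ((g : Γ × M).1)⁻¹ * τ ∈ Set.range f :=
      (hq _).1 (by rw [map_mul, map_inv, h1, inv_mul_cancel])
    refine ⟨⟨g * ι σ₀, ?_⟩, ?_⟩
    · rw [hmemS, QuotientGroup.mk_mul, (QuotientGroup.eq_one_iff (N := ι.range) (ι σ₀)).2 ⟨σ₀, rfl⟩, mul_one, hg]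
      exact ⟨q τ, rfl⟩
    · rw [hπ₁]
      show ((g * ι σ₀ : E₀) : Γ × M).1 = τ
      rw [Subgroup.coe_mul, Prod.fst_mul, hι1, hσ₀, mul_inv_cancel_left]
  -- `R := pr₂ ∘ (π₁|S)⁻¹`
  set Φ : S ≃* Γ := MulEquiv.ofBijective π₁ ⟨hinj, hsurj⟩ with hΦ
  refine ⟨((MonoidHom.snd Γ M).comp (E₀.subtype.comp S.subtype)).comp Φ.symm.toMonoidHom, fun σ₀ => ?_⟩
  have hΦι : Φ.symm (f σ₀) = ⟨ι σ₀, hιS σ₀⟩ := by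
    apply Φ.injective
    rw [MulEquiv.apply_symm_apply, hΦ, MulEquiv.ofBijective_apply, hπ₁]
    exact (hι1 σ₀).symm
  show ((((Φ.symm (f σ₀) : S) : E₀) : Γ × M)).2 = r σ₀
  rw [hΦι]
  exact hι2 σ₀

end Abstract

/-! ## §2 KERNEL, Galois side: an invariant irreducible `r` of `Γ_L` whose Clifford obstruction is split EXTENDS to `Γ_K`, continuously (0 sorry) -/

section Galois

variable {K L : Type} [Field K] [NumberField K] [Field L] [NumberField L] [Algebra K L]
variable {ℓ : ℕ} [Fact ℓ.Prime] {n : ℕ}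

/-- `det (u · 1) = u ^ n`. [folklore] -/
theorem det_scalar (u : (PadicAlgCl ℓ)ˣ) : Matrix.GeneralLinearGroup.det (FramedRep.scalar (PadicAlgCl ℓ) n u) = u ^ n := by
  ext
  rw [Matrix.GeneralLinearGroup.val_det_apply, FramedRep.coe_scalar_apply, Algebra.algebraMap_eq_smul_one, Matrix.det_smul,
    Matrix.det_one, mul_one, Fintype.card_fin, Units.val_pow_eq_pow_val]

/-- **Extension across a layer with split Clifford obstruction (general determinant condition).**  `L/K` finite Galois (number fields),
`r : Γ_L → GL_n(ℚ̄_ℓ)` irreducible and `Γ_K`-invariant, `D : GL_n → C` a homomorphism with an (abstract) extension `Ψ : Γ_K → C` of `D ∘ r`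
such that every `θ_τ` is implemented by a matrix of `D`-value `Ψ τ`, and scalars of `D`-value `1` are killed by `e`.  If the central
extensions of `Gal(L/K)` with kernel killed by `e` split, then `r = ρ|Γ_L` for a CONTINUOUS `ρ : Γ_K → GL_n(ℚ̄_ℓ)` (continuity: `ρ` is a
homomorphism continuous on the open subgroup `Γ_L`, tree `isOpenEmbedding_absGaloisRestrict`). -/
theorem exists_restrictField_eq_of_split [IsGalois K L] {C : Type} [CommGroup C]
    (r : FramedGaloisRep L (PadicAlgCl ℓ) n) (hirr : r.IsIrreducible)
    (D : GL (Fin n) (PadicAlgCl ℓ) →* C) (Ψ : Field.absoluteGaloisGroup K →* C)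
    (hΨ : ∀ σ, Ψ (absGaloisRestrict K L σ) = D (r σ)) (e : ℕ)
    (hstab : ∀ τ : Field.absoluteGaloisGroup K, ∃ P : GL (Fin n) (PadicAlgCl ℓ),
      (∀ σ, r (absGaloisOuterConj K L τ σ) = P * r σ * P⁻¹) ∧ D P = Ψ τ)
    (htors : ∀ u : (PadicAlgCl ℓ)ˣ, D (FramedRep.scalar (PadicAlgCl ℓ) n u) = 1 → FramedRep.scalar (PadicAlgCl ℓ) n u ^ e = 1)
    (hsplit : CentralExtensionsSplitMod e (L ≃ₐ[K] L)) :
    ∃ ρ : FramedGaloisRep K (PadicAlgCl ℓ) n, ρ.restrictField L = r := by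
  haveI : FiniteDimensional K L := Module.Finite.of_restrictScalars_finite ℚ K L
  have hn : 0 < n := hirr.rank_pos
  haveI : Nonempty (Fin n) := ⟨⟨0, hn⟩⟩
  -- Schur: self-intertwiners of determinant-value 1 are scalars killed by `e`, and central
  have hSchur : ∀ P : GL (Fin n) (PadicAlgCl ℓ), (∀ σ, P * r.toMonoidHom σ = r.toMonoidHom σ * P) → D P = 1 →
      P ^ e = 1 ∧ ∀ X : GL (Fin n) (PadicAlgCl ℓ), P * X = X * P := by
    intro P hcomm hdet
    obtain ⟨c, hc⟩ := FramedRep.exists_eq_scalar_of_forall_commute hirr (P : Matrix (Fin n) (Fin n) (PadicAlgCl ℓ)) fun σ => by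
      rw [← Units.val_mul, ← Units.val_mul]
      exact congrArg Units.val (hcomm σ)
    have hc0 : c ≠ 0 := fun h0 => by
      have hdet' := P.isUnit.map Matrix.detMonoidHom
      rw [Matrix.coe_detMonoidHom, hc, h0, map_zero, Matrix.det_zero] at hdet'
      exact not_isUnit_zero hdet'
    have hP : P = FramedRep.scalar (PadicAlgCl ℓ) n (Units.mk0 c hc0) :=
      Units.ext (by rw [hc, FramedRep.coe_scalar_apply, Units.val_mk0])
    refine ⟨by rw [hP]; exact htors _ (by rw [← hP]; exact hdet), fun X => by rw [hP]; exact FramedRep.scalar_mul_comm _ _⟩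
  obtain ⟨R, hR⟩ := exists_monoidHom_comp_eq_of_centralExtensionsSplitMod (absGaloisRestrict K L).toMonoidHom
    (absGaloisRestrict_injective K L) (fun τ σ => absGaloisOuterConj K L τ σ) (fun τ σ => absGaloisRestrict_absGaloisOuterConj K L τ σ)
    (absGaloisQuot K L) (absGaloisQuot_surjective K L) (fun τ => by rw [absGaloisQuot_eq_one_iff]; rfl) r.toMonoidHom D Ψ hΨ e
    hstab hSchur hsplit
  -- continuity: a homomorphism continuous on the open subgroup `Γ_L`
  have hRf : ∀ σ, R (absGaloisRestrict K L σ) = r σ := hR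
  have hcont : Continuous R := by
    apply continuous_of_continuousAt_one R
    have h1 : ContinuousAt (R ∘ absGaloisRestrict K L) 1 := by
      have h2 : (R : Field.absoluteGaloisGroup K → GL (Fin n) (PadicAlgCl ℓ)) ∘ absGaloisRestrict K L = r := funext hRf
      rw [h2]
      exact (map_continuous r).continuousAt
    have h3 := (isOpenEmbedding_absGaloisRestrict K L).continuousAt_iff.1 h1
    rwa [map_one] at h3
  exact ⟨{ toMonoidHom := R, continuous_toFun := hcont }, ContinuousMonoidHom.ext hRf⟩

omit [NumberField K] in
/-- From `conj P (r^τ) = r` (the tree's invariance format) to «`P⁻¹` implements `θ_τ` on `r`». -/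
theorem implements_of_conj_outerConj [IsGalois K L] (r : FramedGaloisRep L (PadicAlgCl ℓ) n) (τ : Field.absoluteGaloisGroup K)
    (P : GL (Fin n) (PadicAlgCl ℓ)) (hP : FramedRep.conj P (FramedGaloisRep.outerConj τ r) = r) (σ : Field.absoluteGaloisGroup L) :
    r (absGaloisOuterConj K L τ σ) = P⁻¹ * r σ * P⁻¹⁻¹ := by
  have h := congrArg (fun ρ : FramedGaloisRep L (PadicAlgCl ℓ) n => ρ σ) hP
  simp only [FramedRep.conj_apply, FramedGaloisRep.outerConj_apply] at h
  rw [← h]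
  group

/-- **Extension given a determinant descent** (`D = det`, `e = n`): if `det r = Ψ|Γ_L` for an (abstract) character `Ψ` of `Γ_K` and the
central `μ_n`-type extensions of `Gal(L/K)` split, an invariant irreducible `r` is `ρ|Γ_L` for a continuous `ρ` over `K`. -/
theorem exists_restrictField_eq_of_det [IsGalois K L] (r : FramedGaloisRep L (PadicAlgCl ℓ) n) (hirr : r.IsIrreducible)
    (hinv : ∀ τ : Field.absoluteGaloisGroup K, ∃ P : GL (Fin n) (PadicAlgCl ℓ), FramedRep.conj P (FramedGaloisRep.outerConj τ r) = r)
    (Ψ : Field.absoluteGaloisGroup K →* (PadicAlgCl ℓ)ˣ) (hΨ : ∀ σ, Ψ (absGaloisRestrict K L σ) = Matrix.GeneralLinearGroup.det (r σ))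
    (hsplit : CentralExtensionsSplitMod n (L ≃ₐ[K] L)) :
    ∃ ρ : FramedGaloisRep K (PadicAlgCl ℓ) n, ρ.restrictField L = r := by
  have hn : 0 < n := hirr.rank_pos
  refine exists_restrictField_eq_of_split r hirr Matrix.GeneralLinearGroup.det Ψ hΨ n (fun τ => ?_) (fun u hu => ?_) hsplit
  · obtain ⟨P₀, hP₀⟩ := hinv τ
    have h0 := implements_of_conj_outerConj r τ P₀ hP₀
    -- rescale `P₀⁻¹` by an `n`-th root of `Ψ τ / det P₀⁻¹`
    obtain ⟨c, hc⟩ := IsAlgClosed.exists_pow_nat_eq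
      (((Ψ τ * (Matrix.GeneralLinearGroup.det P₀⁻¹)⁻¹ : (PadicAlgCl ℓ)ˣ)) : PadicAlgCl ℓ) hn
    have hc0 : c ≠ 0 := by
      rintro rfl
      rw [zero_pow hn.ne'] at hc
      exact (Ψ τ * (Matrix.GeneralLinearGroup.det P₀⁻¹)⁻¹).ne_zero hc.symm
    refine ⟨FramedRep.scalar (PadicAlgCl ℓ) n (Units.mk0 c hc0) * P₀⁻¹, fun σ => ?_, ?_⟩
    · rw [h0 σ]
      symm
      calc FramedRep.scalar (PadicAlgCl ℓ) n (Units.mk0 c hc0) * P₀⁻¹ * r σ * (FramedRep.scalar (PadicAlgCl ℓ) n (Units.mk0 c hc0) * P₀⁻¹)⁻¹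
          = FramedRep.scalar (PadicAlgCl ℓ) n (Units.mk0 c hc0) * (P₀⁻¹ * r σ * P₀⁻¹⁻¹) * (FramedRep.scalar (PadicAlgCl ℓ) n (Units.mk0 c hc0))⁻¹ := by
            group
        _ = P₀⁻¹ * r σ * P₀⁻¹⁻¹ * FramedRep.scalar (PadicAlgCl ℓ) n (Units.mk0 c hc0) * (FramedRep.scalar (PadicAlgCl ℓ) n (Units.mk0 c hc0))⁻¹ := by
            rw [FramedRep.scalar_mul_comm _ (P₀⁻¹ * r σ * P₀⁻¹⁻¹)]
        _ = P₀⁻¹ * r σ * P₀⁻¹⁻¹ := by group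
    · rw [map_mul, det_scalar]
      apply Units.ext
      rw [Units.val_mul, Units.val_pow_eq_pow_val, Units.val_mk0, hc, ← Units.val_mul, inv_mul_cancel_right]
  · rw [det_scalar] at hu
    rw [← map_pow, hu, map_one]

/-- **Extension on a superperfect layer** (`D = 1`, `e = 0`): if ALL central extensions of `Gal(L/K)` split, an invariant irreducible `r` of `Γ_L`
is `ρ|Γ_L` for a continuous `ρ` over `K` — no determinant input. -/
theorem exists_restrictField_eq_of_superperfect [IsGalois K L] (r : FramedGaloisRep L (PadicAlgCl ℓ) n) (hirr : r.IsIrreducible)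
    (hinv : ∀ τ : Field.absoluteGaloisGroup K, ∃ P : GL (Fin n) (PadicAlgCl ℓ), FramedRep.conj P (FramedGaloisRep.outerConj τ r) = r)
    (hsplit : ∀ (E : Type) [Group E] (p : E →* (L ≃ₐ[K] L)), Function.Surjective p → (∀ z : E, p z = 1 → z ∈ Subgroup.center E) →
      ∃ s : (L ≃ₐ[K] L) →* E, ∀ x, p (s x) = x) :
    ∃ ρ : FramedGaloisRep K (PadicAlgCl ℓ) n, ρ.restrictField L = r := by
  refine exists_restrictField_eq_of_split (C := (PadicAlgCl ℓ)ˣ) r hirr 1 1 (fun σ => rfl) 0 (fun τ => ?_) (fun u hu => pow_zero _)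
    (centralExtensionsSplitMod_of_all 0 hsplit)
  obtain ⟨P₀, hP₀⟩ := hinv τ
  exact ⟨P₀⁻¹, implements_of_conj_outerConj r τ P₀ hP₀, rfl⟩

end Galois

end Summit.Langlands.Langlands.Theorems.SchurObstructionExit
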